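import Mathlib
import HarnessLib
import Literature.MathematicalPhysics.QuantumFieldTheory.OSReconstructionNoE1
import Literature.MathematicalPhysics.QuantumFieldTheory.LatticeMirrorNormals
import Summits.QuantumFields.YangMills.Theorems.PencilRigidityCurvatureKernelBoundChartDerivativeBoundsFrame

/-!
# `CurvatureKernelBound` — stub A3 support: reflection-positive frames for the 16 mirrors

Support file for crux `stmt-QuantumFields-11687` (`PencilRigidity.CurvatureKernelBound`), line
`sixteen-charts-analytic-kernel`, stub `KernelOffDiagonal` (A3).

* two one-species Schwinger families that agree on `⁰𝒮` have the same E2 (reflection positivity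
  only evaluates a family on off-diagonal test functions `θFᵢ* ⊗ Fⱼ`);
* hence a symmetry `P` of `𝔖` on `⁰𝒮` transports E2 of a pulled-back family `𝔖 ∘ R` to `𝔖 ∘ (P ∘ R)`;
* proper signed permutations of `ℝ⁴` with prescribed first two columns (determinant fixed by an
  extra coordinate reflection), the `45°` frame in the `(0,1)`-plane;
* for a family invariant under proper signed permutations and reflection positive in the diagonal
  frames, every oriented mirror normal `±eμ`, `(eμ ± eν)/√2` is `R e₀` for a frame `R` in which the
  pulled-back family is reflection positive, and at every `ξ ≠ 0` four linearly independent such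
  normals have `⟪ξ, n⟫ < 0` (registered sub-goal `GoodMirrorFrames`).
[folklore]
-/

noncomputable section

open scoped InnerProductSpace SchwartzMap
open Literature.MathematicalPhysics.AQFT Literature.MathematicalPhysics.QuantumLattice
open Literature.MathematicalPhysics.QuantumFieldTheory

namespace Summit.QuantumFields.YangMills.Theorems.CurvatureKernel

/-! ## Families agreeing on `⁰𝒮` -/

section Agree

variable {d : ℕ} [NeZero d]

/-- **Two one-species families agreeing on `⁰𝒮` have the same E2**: the reflection-positivity sums
only evaluate the family on the witnesses `H i j = θFᵢ* ⊗ Fⱼ`, which are off-diagonal for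
time-ordered `Fᵢ, Fⱼ`. [folklore] -/
theorem isReflectionPositive_of_forall_isOffDiagonal_eq
    {S S' : SchwingerFamily (EuclideanSpace ℝ (Fin d))}
    (h : ∀ (n : ℕ) (F : 𝓢((Fin n → EuclideanSpace ℝ (Fin d)), ℂ)), IsOffDiagonal F → S' n F = S n F)
    (hS : S.toLabelled.IsReflectionPositive) : S'.toLabelled.IsReflectionPositive := by
  intro N deg lab F hF H hH
  have key : ∀ i j, S'.toLabelled (deg i + deg j) (Fin.append (lab i ∘ Fin.rev) (lab j)) (H i j) =
      S.toLabelled (deg i + deg j) (Fin.append (lab i ∘ Fin.rev) (lab j)) (H i j) := by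
    intro i j
    rw [SchwingerFamily.toLabelled_apply, SchwingerFamily.toLabelled_apply]
    refine h _ _ ?_
    have hHeq : H i j = (osAdjoint (F i)).appendTensor (F j) := by
      ext x
      rw [hH i j x, SchwartzMap.appendTensor_apply]
    rw [hHeq]
    exact OSReconstructionNoE1.isOffDiagonal_appendTensor_osAdjoint (hF i) (hF j)
  simp only [key]
  exact hS N deg lab F hF H hH

variable {E' : Type*} [NormedAddCommGroup E'] [NormedSpace ℝ E'] {n : ℕ}

/-- `linActMulti (R.trans P) = linActMulti P ∘ linActMulti R`. [folklore] -/
theorem linActMulti_trans (R P : E' ≃ₗᵢ[ℝ] E') (F : 𝓢((Fin n → E'), ℂ)) :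
    linActMulti (R.trans P) F = linActMulti P (linActMulti R F) := by
  ext x
  rfl

/-- **A symmetry on `⁰𝒮` preserves E2**: if `𝔖ₙ(F ∘ P⁻¹) = 𝔖ₙ(F)` on `⁰𝒮` then the pulled-back
family `𝔖 ∘ linActMulti P` is reflection positive when `𝔖` is. [folklore] -/
theorem isReflectionPositive_comp_linActMulti_of_invariant (S₁ : SchwingerFamily (EuclideanSpace ℝ (Fin d)))
    (P : EuclideanSpace ℝ (Fin d) ≃ₗᵢ[ℝ] EuclideanSpace ℝ (Fin d))
    (hP : ∀ (n : ℕ) (F : 𝓢((Fin n → EuclideanSpace ℝ (Fin d)), ℂ)), IsOffDiagonal F →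
      S₁ n (linActMulti P F) = S₁ n F)
    (hE2 : S₁.toLabelled.IsReflectionPositive) :
    (SchwingerFamily.toLabelled fun n => (S₁ n).comp (linActMulti P)).IsReflectionPositive :=
  isReflectionPositive_of_forall_isOffDiagonal_eq (S := S₁) (fun n F hF => by
    show S₁ n (linActMulti P F) = S₁ n F
    exact hP n F hF) hE2

/-- **Transport of E2 along a symmetry**: if `P` is a symmetry of `𝔖` on `⁰𝒮` and `𝔖 ∘ linActMulti R`
is reflection positive, so is `𝔖 ∘ linActMulti (R.trans P)` (the two families agree on `⁰𝒮`).
[folklore] -/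
theorem isReflectionPositive_comp_linActMulti_trans (S₁ : SchwingerFamily (EuclideanSpace ℝ (Fin d)))
    (R P : EuclideanSpace ℝ (Fin d) ≃ₗᵢ[ℝ] EuclideanSpace ℝ (Fin d))
    (hP : ∀ (n : ℕ) (F : 𝓢((Fin n → EuclideanSpace ℝ (Fin d)), ℂ)), IsOffDiagonal F →
      S₁ n (linActMulti P F) = S₁ n F)
    (hR : (SchwingerFamily.toLabelled fun n => (S₁ n).comp (linActMulti R)).IsReflectionPositive) :
    (SchwingerFamily.toLabelled fun n => (S₁ n).comp (linActMulti (R.trans P))).IsReflectionPositive :=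
  isReflectionPositive_of_forall_isOffDiagonal_eq (S := fun n => (S₁ n).comp (linActMulti R))
    (fun n F hF => by
      show S₁ n (linActMulti (R.trans P) F) = S₁ n (linActMulti R F)
      rw [linActMulti_trans]
      exact hP n _ (isOffDiagonal_linActMulti R hF)) hR

end Agree

/-! ## Linear isometries of `ℝ^d`: determinants, coordinate reflections, prescribed frames -/

section Isometries

variable {d : ℕ}

/-- A linear isometry of `ℝ^d` has determinant `±1`. [folklore] -/
theorem det_toLinearEquiv_eq_one_or (R : EuclideanSpace ℝ (Fin d) ≃ₗᵢ[ℝ] EuclideanSpace ℝ (Fin d)) :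
    LinearMap.det (R.toLinearEquiv : EuclideanSpace ℝ (Fin d) →ₗ[ℝ] EuclideanSpace ℝ (Fin d)) = 1 ∨
      LinearMap.det (R.toLinearEquiv : EuclideanSpace ℝ (Fin d) →ₗ[ℝ] EuclideanSpace ℝ (Fin d)) = -1 := by
  set b := EuclideanSpace.basisFun (Fin d) ℝ
  have h := OrthonormalBasis.det_to_matrix_orthonormalBasis_real b (b.map R)
  have hcomp : (⇑(b.map R) : Fin d → EuclideanSpace ℝ (Fin d)) =
      ⇑(R.toLinearEquiv : EuclideanSpace ℝ (Fin d) →ₗ[ℝ] EuclideanSpace ℝ (Fin d)) ∘ ⇑b.toBasis := by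
    funext i
    simp [OrthonormalBasis.coe_toBasis]
  rw [hcomp, Module.Basis.det_comp, Module.Basis.det_self, mul_one] at h
  exact h

/-- The reflection in a coordinate hyperplane `x_k = 0` has determinant `-1`. [folklore] -/
theorem det_reflection_single (k : Fin d) :
    LinearMap.det (((ℝ ∙ EuclideanSpace.single k (1 : ℝ))ᗮ.reflection.toLinearEquiv :
      EuclideanSpace ℝ (Fin d) →ₗ[ℝ] EuclideanSpace ℝ (Fin d))) = -1 := by
  have hne : (EuclideanSpace.single k (1 : ℝ) : EuclideanSpace ℝ (Fin d)) ≠ 0 := fun h => by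
    simpa using congrArg (fun v : EuclideanSpace ℝ (Fin d) => v k) h
  rw [Submodule.det_reflection, Submodule.orthogonal_orthogonal, finrank_span_singleton hne, pow_one]

/-- The coordinate reflection on basis vectors: `e_i ↦ -e_i` for `i = k`, `e_i ↦ e_i` otherwise. [folklore] -/
theorem reflection_single_apply_single (k i : Fin d) :
    ((ℝ ∙ EuclideanSpace.single k (1 : ℝ))ᗮ.reflection (EuclideanSpace.single i (1 : ℝ)) :
        EuclideanSpace ℝ (Fin d)) =
      if i = k then -EuclideanSpace.single i 1 else EuclideanSpace.single i 1 := by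
  ext l
  rw [reflection_single_apply]
  by_cases hik : i = k
  · subst hik
    rw [if_pos rfl]
    by_cases hl : l = i
    · rw [if_pos hl]; rfl
    · rw [if_neg hl, PiLp.neg_apply, PiLp.single_apply, if_neg hl, neg_zero]
  · rw [if_neg hik]
    by_cases hl : l = k
    · subst hl; rw [if_pos rfl, PiLp.single_apply, if_neg (Ne.symm hik), neg_zero]
    · rw [if_neg hl]

/-- **Frames with prescribed orthonormal columns**: an orthonormal `d`-tuple `v` in `ℝ^d` is
`(R e_i)ᵢ` for a linear isometry `R`. [folklore] -/
theorem exists_linearIsometryEquiv_apply_single_eq [NeZero d] {v : Fin d → EuclideanSpace ℝ (Fin d)}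
    (hv : Orthonormal ℝ v) :
    ∃ R : EuclideanSpace ℝ (Fin d) ≃ₗᵢ[ℝ] EuclideanSpace ℝ (Fin d),
      ∀ i, R (EuclideanSpace.single i 1) = v i := by
  have hsp : ⊤ ≤ Submodule.span ℝ (Set.range v) :=
    (hv.linearIndependent.span_eq_top_of_card_eq_finrank' (by simp)).ge
  refine ⟨(OrthonormalBasis.mk hv hsp).repr.symm, fun i => ?_⟩
  rw [OrthonormalBasis.repr_symm_single, OrthonormalBasis.coe_mk]

/-- **Proper signed permutations with prescribed first two columns**: for `μ ≠ ν` and signs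
`s, t ∈ {±1}` there is a linear isometry `P` of `ℝ⁴` of determinant `1` permuting the coordinate
axes up to sign with `P e₀ = s e_μ`, `P e₁ = t e_ν` (complete by `e_α, ±e_β` and fix the
determinant with the reflection in `x₃ = 0`, which fixes `e₀, e₁`). [folklore] -/
theorem exists_signedPerm_frame (μ ν : Fin 4) (hμν : μ ≠ ν) {s t : ℝ} (hs : s = 1 ∨ s = -1)
    (ht : t = 1 ∨ t = -1) :
    ∃ P : EuclideanSpace ℝ (Fin 4) ≃ₗᵢ[ℝ] EuclideanSpace ℝ (Fin 4),
      LinearMap.det (P.toLinearEquiv : EuclideanSpace ℝ (Fin 4) →ₗ[ℝ] EuclideanSpace ℝ (Fin 4)) = 1 ∧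
      (∀ i : Fin 4, ∃ j : Fin 4, P (EuclideanSpace.single i 1) = EuclideanSpace.single j 1 ∨
        P (EuclideanSpace.single i 1) = -EuclideanSpace.single j 1) ∧
      P (EuclideanSpace.single 0 1) = s • EuclideanSpace.single μ 1 ∧
      P (EuclideanSpace.single 1 1) = t • EuclideanSpace.single ν 1 := by
  obtain ⟨σ, hσ0, hσ1⟩ : ∃ σ : Equiv.Perm (Fin 4), σ 0 = μ ∧ σ 1 = ν := by
    revert μ ν
    decide
  -- signs and columns
  let ε : Fin 4 → ℝ := fun i => if i = μ then s else if i = ν then t else 1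
  have hε : ∀ i, ε i = 1 ∨ ε i = -1 := fun i => by
    simp only [ε]; split_ifs; exacts [hs, ht, Or.inl rfl]
  have hε2 : ∀ i, ε i * ε i = 1 := fun i => by rcases hε i with h | h <;> rw [h] <;> norm_num
  let v : Fin 4 → EuclideanSpace ℝ (Fin 4) := fun i => ε (σ i) • EuclideanSpace.single (σ i) 1
  have hv : Orthonormal ℝ v := by
    rw [orthonormal_iff_ite]
    intro i j
    simp only [v, inner_smul_left, inner_smul_right, EuclideanSpace.inner_single_left,
      PiLp.single_apply, conj_trivial, map_one, one_mul]
    by_cases hij : i = j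
    · subst hij
      rw [if_pos rfl, if_pos rfl, mul_one, hε2]
    · rw [if_neg (σ.injective.ne hij), if_neg hij, mul_zero, mul_zero]
  obtain ⟨P', hP'⟩ := exists_linearIsometryEquiv_apply_single_eq hv
  have hsign : ∀ i : Fin 4, ∃ j : Fin 4, P' (EuclideanSpace.single i 1) = EuclideanSpace.single j 1 ∨
      P' (EuclideanSpace.single i 1) = -EuclideanSpace.single j 1 := by
    intro i
    refine ⟨σ i, ?_⟩
    rw [hP']
    rcases hε (σ i) with h | h
    · left; simp [v, h]
    · right; simp [v, h]
  have h0 : P' (EuclideanSpace.single 0 1) = s • EuclideanSpace.single μ 1 := by rw [hP']; simp [v, hσ0, ε]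
  have h1 : P' (EuclideanSpace.single 1 1) = t • EuclideanSpace.single ν 1 := by rw [hP']; simp [v, hσ1, ε, hμν.symm]
  rcases det_toLinearEquiv_eq_one_or P' with hdet | hdet
  · exact ⟨P', hdet, hsign, h0, h1⟩
  · set N := ((ℝ ∙ EuclideanSpace.single (3 : Fin 4) (1 : ℝ))ᗮ).reflection with hN
    refine ⟨N.trans P', ?_, ?_, ?_, ?_⟩
    · have hc : ((N.trans P').toLinearEquiv : EuclideanSpace ℝ (Fin 4) →ₗ[ℝ] EuclideanSpace ℝ (Fin 4)) =
          (P'.toLinearEquiv : EuclideanSpace ℝ (Fin 4) →ₗ[ℝ] EuclideanSpace ℝ (Fin 4)).comp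
            (N.toLinearEquiv : EuclideanSpace ℝ (Fin 4) →ₗ[ℝ] EuclideanSpace ℝ (Fin 4)) := rfl
      rw [hc, LinearMap.det_comp, hdet, hN, det_reflection_single]
      norm_num
    · intro i
      obtain ⟨j, hj⟩ := hsign i
      refine ⟨j, ?_⟩
      rw [LinearIsometryEquiv.trans_apply, hN, reflection_single_apply_single]
      split_ifs
      · rw [map_neg]
        rcases hj with hj | hj
        · right; rw [hj]
        · left; rw [hj, neg_neg]
      · exact hj
    · rw [LinearIsometryEquiv.trans_apply, hN, reflection_single_apply_single, if_neg (by decide), h0]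
    · rw [LinearIsometryEquiv.trans_apply, hN, reflection_single_apply_single, if_neg (by decide), h1]

/-- **The `45°` frame in the `(0,1)`-plane**: a linear isometry `R₀` of `ℝ⁴` with
`R₀ e₀ = (e₀ + e₁)/√2`. [folklore] -/
theorem exists_diagonal_frame :
    ∃ R : EuclideanSpace ℝ (Fin 4) ≃ₗᵢ[ℝ] EuclideanSpace ℝ (Fin 4),
      R (EuclideanSpace.single 0 1) =
        Real.sqrt (1 / 2) • EuclideanSpace.single 0 1 + Real.sqrt (1 / 2) • EuclideanSpace.single 1 1 := by
  set c : ℝ := Real.sqrt (1 / 2) with hcdef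
  have hc : c * c = 1 / 2 := Real.mul_self_sqrt (by norm_num)
  let v : Fin 4 → EuclideanSpace ℝ (Fin 4) :=
    ![c • EuclideanSpace.single 0 1 + c • EuclideanSpace.single 1 1,
      c • EuclideanSpace.single 0 1 - c • EuclideanSpace.single 1 1,
      EuclideanSpace.single 2 1, EuclideanSpace.single 3 1]
  have hv : Orthonormal ℝ v := by
    rw [orthonormal_iff_ite]
    intro i j
    fin_cases i <;> fin_cases j <;>
      simp only [v, Fin.zero_eta, Fin.mk_one, Fin.reduceFinMk, Fin.isValue, Matrix.cons_val,
        Matrix.cons_val_zero, Matrix.cons_val_one, inner_add_left, inner_add_right, inner_sub_left,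
        inner_sub_right, inner_smul_left, inner_smul_right, EuclideanSpace.inner_single_right,
        PiLp.single_apply, conj_trivial, Fin.reduceEq, if_true, if_false] <;>
      norm_num <;> linarith [hc]
  obtain ⟨R, hR⟩ := exists_linearIsometryEquiv_apply_single_eq hv
  exact ⟨R, by rw [hR]; rfl⟩

end Isometries

/-! ## Reflection-positive frames for the oriented mirror normals -/

section MirrorFrames

/-- **Axis normals**: for a family invariant under proper signed permutations on `⁰𝒮` and
reflection positive, each `±e_μ` is `P e₀` for a frame `P` in which the pulled-back family is
reflection positive. [folklore] -/
theorem exists_frame_axis (S₁ : SchwingerFamily (EuclideanSpace ℝ (Fin 4)))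
    (hE2 : S₁.toLabelled.IsReflectionPositive)
    (hH : ∀ (R : (EuclideanSpace ℝ (Fin 4)) ≃ₗᵢ[ℝ] (EuclideanSpace ℝ (Fin 4))), LinearMap.det (R.toLinearEquiv : (EuclideanSpace ℝ (Fin 4)) →ₗ[ℝ] (EuclideanSpace ℝ (Fin 4))) = 1 →
      (∀ i : Fin 4, ∃ j : Fin 4, R (EuclideanSpace.single i 1) = EuclideanSpace.single j 1 ∨ R (EuclideanSpace.single i 1) = -EuclideanSpace.single j 1) →
      ∀ (n : ℕ) (F : 𝓢((Fin n → (EuclideanSpace ℝ (Fin 4))), ℂ)), IsOffDiagonal F → S₁ n (linActMulti R F) = S₁ n F)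
    (μ : Fin 4) {s : ℝ} (hs : s = 1 ∨ s = -1) :
    ∃ R : EuclideanSpace ℝ (Fin 4) ≃ₗᵢ[ℝ] EuclideanSpace ℝ (Fin 4),
      R (EuclideanSpace.single 0 1) = s • EuclideanSpace.single μ 1 ∧
      (SchwingerFamily.toLabelled fun n => (S₁ n).comp (linActMulti R)).IsReflectionPositive := by
  obtain ⟨ν, hν⟩ := exists_ne μ
  obtain ⟨P, hdet, hsign, h0, -⟩ := exists_signedPerm_frame μ ν hν.symm hs (Or.inl rfl)
  exact ⟨P, h0, isReflectionPositive_comp_linActMulti_of_invariant S₁ P (hH P hdet hsign) hE2⟩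

/-- **Diagonal normals**: for a family invariant under proper signed permutations on `⁰𝒮` and
reflection positive in the diagonal frames `R e₀ = a e₀ + b e₁`, `a² = b² = 1/2`, each
`(s e_μ + t e_ν)/√2` (`μ ≠ ν`, `s, t = ±1`) is `R e₀` for a frame `R` in which the pulled-back family
is reflection positive (`R = P ∘ R₀`, which agrees with `𝔖 ∘ R₀` on `⁰𝒮`). [folklore] -/
theorem exists_frame_diagonal (S₁ : SchwingerFamily (EuclideanSpace ℝ (Fin 4)))
    (hH : ∀ (R : (EuclideanSpace ℝ (Fin 4)) ≃ₗᵢ[ℝ] (EuclideanSpace ℝ (Fin 4))), LinearMap.det (R.toLinearEquiv : (EuclideanSpace ℝ (Fin 4)) →ₗ[ℝ] (EuclideanSpace ℝ (Fin 4))) = 1 →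
      (∀ i : Fin 4, ∃ j : Fin 4, R (EuclideanSpace.single i 1) = EuclideanSpace.single j 1 ∨ R (EuclideanSpace.single i 1) = -EuclideanSpace.single j 1) →
      ∀ (n : ℕ) (F : 𝓢((Fin n → (EuclideanSpace ℝ (Fin 4))), ℂ)), IsOffDiagonal F → S₁ n (linActMulti R F) = S₁ n F)
    (hD : ∀ (R : (EuclideanSpace ℝ (Fin 4)) ≃ₗᵢ[ℝ] (EuclideanSpace ℝ (Fin 4))) (a b : ℝ), a ^ 2 = 1 / 2 → b ^ 2 = 1 / 2 →
      R (EuclideanSpace.single 0 1) = a • EuclideanSpace.single 0 1 + b • EuclideanSpace.single 1 1 → (SchwingerFamily.toLabelled (fun n => (S₁ n).comp (linActMulti R))).IsReflectionPositive)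
    (μ ν : Fin 4) (hμν : μ ≠ ν) {s t : ℝ} (hs : s = 1 ∨ s = -1) (ht : t = 1 ∨ t = -1) :
    ∃ R : EuclideanSpace ℝ (Fin 4) ≃ₗᵢ[ℝ] EuclideanSpace ℝ (Fin 4),
      R (EuclideanSpace.single 0 1) =
        Real.sqrt (1 / 2) • (s • EuclideanSpace.single μ 1 + t • EuclideanSpace.single ν 1) ∧
      (SchwingerFamily.toLabelled fun n => (S₁ n).comp (linActMulti R)).IsReflectionPositive := by
  obtain ⟨R₀, hR₀⟩ := exists_diagonal_frame
  obtain ⟨P, hdet, hsign, h0, h1⟩ := exists_signedPerm_frame μ ν hμν hs ht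
  have hsq : Real.sqrt (1 / 2) ^ 2 = 1 / 2 := Real.sq_sqrt (by norm_num)
  refine ⟨R₀.trans P, ?_, ?_⟩
  · rw [LinearIsometryEquiv.trans_apply, hR₀, map_add, LinearIsometryEquiv.map_smul,
      LinearIsometryEquiv.map_smul, h0, h1, smul_add]
  · exact isReflectionPositive_comp_linActMulti_trans S₁ R₀ P (hH P hdet hsign) (hD R₀ _ _ hsq hsq hR₀)

/-- **Good frames at a nonzero vector** (the combinatorial heart of the sixteen-mirror chart
argument): at every `ξ ≠ 0` there are four linearly independent oriented mirror normals `n_j` with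
`⟪ξ, n_j⟫ < 0`, each of the form `R_j e₀` for a frame `R_j` in which the pulled-back family is
reflection positive.  Construction: with `ξ_{j₀} ≠ 0`, take `n_i = -sgn(ξ_i) e_i` if `ξ_i ≠ 0` and
`n_i = (e_i - sgn(ξ_{j₀}) e_{j₀})/√2` otherwise. [folklore] -/
theorem exists_good_frames (S₁ : SchwingerFamily (EuclideanSpace ℝ (Fin 4)))
    (hE2 : S₁.toLabelled.IsReflectionPositive)
    (hH : ∀ (R : (EuclideanSpace ℝ (Fin 4)) ≃ₗᵢ[ℝ] (EuclideanSpace ℝ (Fin 4))), LinearMap.det (R.toLinearEquiv : (EuclideanSpace ℝ (Fin 4)) →ₗ[ℝ] (EuclideanSpace ℝ (Fin 4))) = 1 →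
      (∀ i : Fin 4, ∃ j : Fin 4, R (EuclideanSpace.single i 1) = EuclideanSpace.single j 1 ∨ R (EuclideanSpace.single i 1) = -EuclideanSpace.single j 1) →
      ∀ (n : ℕ) (F : 𝓢((Fin n → (EuclideanSpace ℝ (Fin 4))), ℂ)), IsOffDiagonal F → S₁ n (linActMulti R F) = S₁ n F)
    (hD : ∀ (R : (EuclideanSpace ℝ (Fin 4)) ≃ₗᵢ[ℝ] (EuclideanSpace ℝ (Fin 4))) (a b : ℝ), a ^ 2 = 1 / 2 → b ^ 2 = 1 / 2 →
      R (EuclideanSpace.single 0 1) = a • EuclideanSpace.single 0 1 + b • EuclideanSpace.single 1 1 → (SchwingerFamily.toLabelled (fun n => (S₁ n).comp (linActMulti R))).IsReflectionPositive)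
    (ξ : EuclideanSpace ℝ (Fin 4)) (hξ : ξ ≠ 0) :
    ∃ nrm : Fin 4 → EuclideanSpace ℝ (Fin 4), LinearIndependent ℝ nrm ∧
      ∀ j, ⟪ξ, nrm j⟫_ℝ < 0 ∧
        ∃ R : EuclideanSpace ℝ (Fin 4) ≃ₗᵢ[ℝ] EuclideanSpace ℝ (Fin 4),
          R (EuclideanSpace.single 0 1) = nrm j ∧
          (SchwingerFamily.toLabelled fun n => (S₁ n).comp (linActMulti R)).IsReflectionPositive := by
  obtain ⟨j₀, hj₀⟩ : ∃ j₀, ξ j₀ ≠ 0 := by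
    by_contra h; push Not at h; exact hξ (PiLp.ext fun i => by simpa using h i)
  -- signs `sg i = -sgn ξ_i`
  let sg : Fin 4 → ℝ := fun i => if 0 ≤ ξ i then -1 else 1
  have hsg : ∀ i, sg i = 1 ∨ sg i = -1 := fun i => by
    simp only [sg]; split_ifs; exacts [Or.inr rfl, Or.inl rfl]
  have hsg_ne : ∀ i, sg i ≠ 0 := fun i => by rcases hsg i with h | h <;> rw [h] <;> norm_num
  have hsg_mul : ∀ i, ξ i ≠ 0 → sg i * ξ i < 0 := fun i hi => by
    simp only [sg]
    split_ifs with h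
    · linarith [lt_of_le_of_ne h (Ne.symm hi)]
    · linarith [lt_of_not_ge h]
  set c : ℝ := Real.sqrt (1 / 2) with hcdef
  have hcpos : 0 < c := Real.sqrt_pos.2 (by norm_num)
  let nrm : Fin 4 → EuclideanSpace ℝ (Fin 4) := fun i =>
    if ξ i ≠ 0 then sg i • EuclideanSpace.single i 1
    else c • (EuclideanSpace.single i 1 + sg j₀ • EuclideanSpace.single j₀ 1)
  -- coordinates of the normals
  have hoff : ∀ i k, k ≠ i → k ≠ j₀ → nrm i k = 0 := by
    intro i k hki hkj
    by_cases hi : ξ i ≠ 0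
    · have : nrm i = sg i • EuclideanSpace.single i 1 := by simp only [nrm, if_pos hi]
      rw [this, PiLp.smul_apply, PiLp.single_apply, if_neg hki, smul_zero]
    · have : nrm i = c • (EuclideanSpace.single i 1 + sg j₀ • EuclideanSpace.single j₀ 1) := by
        simp only [nrm, if_neg hi]
      rw [this, PiLp.smul_apply, PiLp.add_apply, PiLp.smul_apply, PiLp.single_apply, PiLp.single_apply,
        if_neg hki, if_neg hkj, smul_zero, add_zero, smul_zero]
  have hdiag : ∀ k, nrm k k ≠ 0 := by
    intro k
    by_cases hk : ξ k ≠ 0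
    · have : nrm k = sg k • EuclideanSpace.single k 1 := by simp only [nrm, if_pos hk]
      rw [this, PiLp.smul_apply, PiLp.single_apply, if_pos rfl, smul_eq_mul, mul_one]
      exact hsg_ne k
    · have : nrm k = c • (EuclideanSpace.single k 1 + sg j₀ • EuclideanSpace.single j₀ 1) := by
        simp only [nrm, if_neg hk]
      have hkj : k ≠ j₀ := fun h => hk (h ▸ hj₀)
      rw [this, PiLp.smul_apply, PiLp.add_apply, PiLp.smul_apply, PiLp.single_apply, PiLp.single_apply,
        if_pos rfl, if_neg hkj, smul_zero, add_zero, smul_eq_mul, mul_one]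
      exact hcpos.ne'
  refine ⟨nrm, ?_, fun j => ⟨?_, ?_⟩⟩
  · -- linear independence
    rw [Fintype.linearIndependent_iff]
    intro g hg
    have hcoord : ∀ k, ∑ i, g i * nrm i k = 0 := fun k => by
      have := congrArg (fun v : EuclideanSpace ℝ (Fin 4) => v k) hg
      simpa using this
    have hstep : ∀ k, k ≠ j₀ → g k = 0 := by
      intro k hk
      have h := hcoord k
      rw [Finset.sum_eq_single k (fun i _ hik => by rw [hoff i k (Ne.symm hik) hk, mul_zero])
        (fun h => absurd (Finset.mem_univ k) h)] at h
      exact (mul_eq_zero.1 h).resolve_right (hdiag k)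
    intro i
    by_cases hi : i = j₀
    · subst hi
      have h := hcoord i
      rw [Finset.sum_eq_single i (fun k _ hki => by rw [hstep k hki, zero_mul])
        (fun h => absurd (Finset.mem_univ i) h)] at h
      exact (mul_eq_zero.1 h).resolve_right (hdiag i)
    · exact hstep i hi
  · -- sign of the inner product
    by_cases hj : ξ j ≠ 0
    · have : nrm j = sg j • EuclideanSpace.single j 1 := by simp only [nrm, if_pos hj]
      rw [this, inner_smul_right, EuclideanSpace.inner_single_right, one_mul, conj_trivial]
      exact hsg_mul j hj
    · have : nrm j = c • (EuclideanSpace.single j 1 + sg j₀ • EuclideanSpace.single j₀ 1) := by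
        simp only [nrm, if_neg hj]
      push Not at hj
      rw [this, inner_smul_right, inner_add_right, inner_smul_right, EuclideanSpace.inner_single_right,
        EuclideanSpace.inner_single_right, one_mul, one_mul, conj_trivial, conj_trivial, hj, zero_add]
      exact mul_neg_of_pos_of_neg hcpos (hsg_mul j₀ hj₀)
  · -- the frame
    by_cases hj : ξ j ≠ 0
    · have : nrm j = sg j • EuclideanSpace.single j 1 := by simp only [nrm, if_pos hj]
      rw [this]
      exact exists_frame_axis S₁ hE2 hH j (hsg j)
    · have : nrm j = c • ((1 : ℝ) • EuclideanSpace.single j 1 + sg j₀ • EuclideanSpace.single j₀ 1) := by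
        simp only [nrm, if_neg hj, one_smul]
      rw [this]
      have hjj : j ≠ j₀ := fun h => hj (h ▸ hj₀)
      exact exists_frame_diagonal S₁ hH hD j j₀ hjj (Or.inl rfl) (hsg j₀)

end MirrorFrames

/-- **Sub-goal `GoodMirrorFrames`** (helper for stub `KernelOffDiagonal`): for a one-species family
on `ℝ⁴` which is reflection positive, invariant under proper signed permutations on `⁰𝒮` and
reflection positive in the diagonal frames of the `(0,1)`-plane, at every `ξ ≠ 0` there are four
linearly independent oriented mirror normals `n_j = R_j e₀` with `⟪ξ, n_j⟫ < 0` and `𝔖 ∘ linActMulti R_j`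
reflection positive. [folklore] -/
theorem GoodMirrorFrames : open Literature.MathematicalPhysics.QuantumLattice Literature.MathematicalPhysics.AQFT Literature.MathematicalPhysics.QuantumFieldTheory in ∀ (S₁ : SchwingerFamily (EuclideanSpace ℝ (Fin 4))), S₁.toLabelled.IsReflectionPositive → (∀ (R : (EuclideanSpace ℝ (Fin 4)) ≃ₗᵢ[ℝ] (EuclideanSpace ℝ (Fin 4))), LinearMap.det (R.toLinearEquiv : (EuclideanSpace ℝ (Fin 4)) →ₗ[ℝ] (EuclideanSpace ℝ (Fin 4))) = 1 → (∀ i : Fin 4, ∃ j : Fin 4, R (EuclideanSpace.single i 1) = EuclideanSpace.single j 1 ∨ R (EuclideanSpace.single i 1) = -EuclideanSpace.single j 1) → ∀ (n : ℕ) (F : SchwartzMap (Fin n → (EuclideanSpace ℝ (Fin 4))) ℂ), IsOffDiagonal F → S₁ n (linActMulti R F) = S₁ n F) → (∀ (R : (EuclideanSpace ℝ (Fin 4)) ≃ₗᵢ[ℝ] (EuclideanSpace ℝ (Fin 4))) (a b : ℝ), a ^ 2 = 1 / 2 → b ^ 2 = 1 / 2 → R (EuclideanSpace.single 0 1) = a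 • EuclideanSpace.single 0 1 + b • EuclideanSpace.single 1 1 → (SchwingerFamily.toLabelled (fun n => (S₁ n).comp (linActMulti R))).IsReflectionPositive) → ∀ ξ : EuclideanSpace ℝ (Fin 4), ξ ≠ 0 → ∃ nrm : Fin 4 → EuclideanSpace ℝ (Fin 4), LinearIndependent ℝ nrm ∧ ∀ j : Fin 4, inner ℝ ξ (nrm j) < 0 ∧ ∃ R : (EuclideanSpace ℝ (Fin 4)) ≃ₗᵢ[ℝ] (EuclideanSpace ℝ (Fin 4)), R (EuclideanSpace.single 0 1) = nrm j ∧ (SchwingerFamily.toLabelled (fun n => (S₁ n).comp (linActMulti R))).IsReflectionPositive := by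
  intro S₁ hE2 hH hD ξ hξ
  exact exists_good_frames S₁ hE2 hH hD ξ hξ

end Summit.QuantumFields.YangMills.Theorems.CurvatureKernel

end
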